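import Summits.QuantumFields.BalabanUV.T4Continuum.Support.LineAveragingMassCommutator
import Summits.QuantumFields.BalabanUV.T4Continuum.Support.DirichletStarVectorTower
import Summits.QuantumFields.BalabanUV.T4Continuum.Support.DirichletDirectionalBesov

/-!
# T⁴ programme, spine node NE2 (U1a), sub-row Δ1 «NE2⁰-Dirichlet» — THE TWO-LEVEL COMMUTATOR OF THE MASS TERM OF THE FAITHFUL STAR-BOND
# OPERATOR `Δ_a(Ω₀)` WITH KING's COMPRESSED PLANTING: `‖JpR_k·massA_{n_k} − massA_{n_{k+1}}·JpR_k‖ ≤ 4a·(√n_k)⁻¹` for EVERY union of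
# blocks, with the sharper vector form `3a·n_k⁻¹·‖u‖ + a·(√n_k)⁻¹·‖P_def u‖`

NE2 formalisation swarm `b2b-balaban-t4-ne2-formalise-*`, LEAF PROVER 07 (gen 8), owner item O14-b′ «W3-BOX-COMPRESSED» (King's compressed
injected law of the star tower, `DirichletStarVectorTower.towerLimitRate_star_of_linear`'s `hinj`; owner g14 rulings R33 (c) / R34 (b), journal
2026-08-20 l.20956 / l.21267: route of record = the commutator PAIRING `⟨v, (J·Δ_a^{(k)}(Ω₀) − Δ_a^{(k+1)}(Ω₀)·J)u⟩` split along `regionDeltaA_eq`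
into (P-gaffney) + (P-gauge) + (P-mass), assembled by `RegionStarInjectedPairing` / `RegionStarPairingBricks`), piece **(P-mass)**
«W3-MASS-PAIRING» (OFFER l.20983, CLAIM l.21413), file 4 of 4 = THE END.  `massA_n := ((a·n^d : ℝ) : ℂ) • ((avgR n M S)ᴴ * avgR n M S)` is
the third summand of `RegionGaugeFixedVector.regionDeltaA_eq` VERBATIM; `C_M := JpR_k * massA_{n_k} − massA_{n_{k+1}} * JpR_k`.

 * §1 `avgR = Q_n·selᴴ`, **`massR_eq_toBlock`** (the mass term of `Δ_a(Ω₀)` IS the compression `(a n^d Q_nᴴQ_n)_{VV}` — [B9] (3.26)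
   «Ω₀(Q*aQ)Ω₀» keeps every row of `Q`), `digits_div_eq` (`digit′/L = digit ∘ par`);
 * §2 **`massComm_eq`**: `C_M = (X_tor)_{V′V} + (X_tr)_{V′V}`, `X_tor = J·massT_n − massT_{n′}·J` the TORUS commutator (the coarse side has NO
   defect by downward closure: `DirichletStarVectorTower.star_down`, `JpcT_vanish`), `X_tr = massT_{n′}·(1 − Π_{V′})·J` the TRUNCATION term (planted
   children of DEFICIENT coarse star bonds that are not fine star bonds); `truncPlant_support` (they lie in the top `L` fine layers:
   `digit_eq_of_blockOf_ne` + `digits_div_eq`), `norm_truncPlant_le` (pointwise majorant by `J·ext(P_def u)`),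
   **`nsq_truncComm_mulVec_le : ‖(X_tr)_{V′V} u‖² ≤ (a²/n_k)·‖P_def u‖²`** (file 3's layer lemma at the fine level, window `L`);
 * §3 THE ENDs: **`sqrt_nsq_massComm_mulVec_le : √nsq(C_M u) ≤ 3a·n_k⁻¹·√nsq u + a·(√n_k)⁻¹·√nsq(P_def u)`**, **`opNorm_massComm_le :
   ‖C_M‖ ≤ 4a·(√n_k)⁻¹`**, `opNorm_massComm_le_rate : ≤ 4a·((√L)⁻¹)^k`, **`mass_pairing_le : ‖⟨v, C_M u⟩‖ ≤ (4a((√L)⁻¹)^k)·√nsq u·√nsq v`** —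
   the (P) currency of `RegionStarInjectedPairing.opNorm_injected_le_of_pairing` with budgets `E = E′ = nsq` (`Λ = Λ′ = ‖G‖`).  `P_def u` is
   written inline, `fun b => if blockReg n_k M S b.1.1 then 0 else u b` (= `RegionStarTrace.defP *ᵥ u` by leaf-06-g6's `defP_mulVec`; with
   `RegionStarTrace.trace_deficient_le` the second END term is `≤ a·n_k⁻¹·√(2·nsq u + Σ_ν nsq (igrad_ν u))`, the `n_k⁻¹` class on interior-W2
   budgets).  The operator-norm rate `n_k^{−1/2}` is
   expected to be sharp for this summand (hand computation on the indicator of one face of deficient bonds — a remark, not a kernel statement).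

HONEST FRAMING (T4-DAG p. 1).  Model level: `U = 1`; ONE region (a decidable set `S` of unit blocks — EVERY union, no box hypothesis),
ONE averaging scale inside `regionDeltaA`, King's componentwise planting compressed to the star bonds; finite torus; linear layer; operator norm;
statements, pairings and constants OURS ([folklore] over landed modules; `[cite:]` tags locate SHAPES).  This bounds ONE summand (the mass
term) of ONE displayed binder (W3 = King's compressed injected law, `DirichletStarVectorTower.towerLimitRate_star_of_linear`'s `hinj`) of the
Δ1 vector layer; the curl/divergence part (P-gaffney), the gauge part (P-gauge) and the interior Hessian budgets (R-hess) are untouched; W3 on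
boxes OPEN; Δ1 NOT closed; NE2 (U1a) NOT proved; spine PROVED 0/9 unchanged; NOT [B9] (3.16)/(3.23)–(3.27) as printed; NOT infinite volume,
NOT a mass gap, NOT the Clay problem, NOT summit progress.  HONEST DEPENDENCY: continuum YM on T⁴ ⇐ BetaPertH ∧ nine spine estimates (0/9
proved); BetaPertH ⇐ (D1) ∧ (D4) ∧ CAP+tail; G-an2-4 gates asym, D1 and NE2/3/4.  No `sorry`.
-/

noncomputable section

open scoped BigOperators ComplexConjugate Matrix Matrix.Norms.L2Operator
open Finset

namespace Summit.QuantumFields.BalabanUV.T4Continuum.RegionMassTwoLevel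

open Literature.MathematicalPhysics.QuantumFieldTheory.Balaban1983to89.B5Prop11Plancherel (Tor fine unitVec)
open Literature.MathematicalPhysics.QuantumFieldTheory.Balaban1983to89.B5Prop11Lower (nsq nsq_nonneg norm_star_dotProduct_le)
open Literature.MathematicalPhysics.QuantumFieldTheory.Balaban1983to89.B5Block118 (bpt tstep QvOp)
open Literature.MathematicalPhysics.QuantumFieldTheory.Balaban1983to89.B5Blocks16 (blockOf)
open Literature.MathematicalPhysics.QuantumFieldTheory.Balaban1983to89.B5G183RateUnitTower (lev)
open Summit.QuantumFields.BalabanUV.T4Continuum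
open Summit.QuantumFields.BalabanUV.T4Continuum.BalabanAveragedTowerUnit (idx cast_lev')
open Summit.QuantumFields.BalabanUV.T4Continuum.BalabanAveragedTowerModes (par val_par)
open Summit.QuantumFields.BalabanUV.T4Continuum.BlockPairingGeometry (parT)
open Summit.QuantumFields.BalabanUV.T4Continuum.KingPairingPlantedLaw (JK JpcT opNorm_JK_le)
open Summit.QuantumFields.BalabanUV.T4Continuum.LineAveragingPairing (JK_mulVec)
open Summit.QuantumFields.BalabanUV.T4Continuum.LineAveragingTwoLevel (val_digits)
open Summit.QuantumFields.BalabanUV.T4Continuum.LineAveragingMassCommutator (nsq_QvOp_mulVec_le_of_layer opNorm_JK_massComm_le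
  toBlock_mulVec_rect nsq_sel_mulVec_le sqrt_nsq_mulVec_le_rect)
open Summit.QuantumFields.BalabanUV.T4Continuum.DirichletDirectionalBesov (sqrt_nsq_add_le)
open Summit.QuantumFields.BalabanUV.T4Continuum.SubtypeCompression (sel ext toBlock_eq_sel sel_mul_sel_conjTranspose opNorm_sel_le
  opNorm_toBlock_le toBlock_mul_of_vanish_left toBlock_smul toBlock_sub toBlock_add mul_sel_conjTranspose_apply nsq_ext ext_apply_of
  ext_apply_of_not)
open Summit.QuantumFields.BalabanUV.T4Continuum.DirichletSubregionTowerOf (pidx JpR JpcT_vanish sel_conjTranspose_mulVec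
  sel_conjTranspose_mul_sel_mulVec JpcT_mulVec_apply)
open Summit.QuantumFields.BalabanUV.T4Continuum.DirichletStarVectorTower (starP star_down blockReg_par_iff digit_eq_of_blockOf_ne)
open Summit.QuantumFields.BalabanUV.T4Continuum.RegionGaugeFixedVector (starReg avgR)
open Summit.QuantumFields.BalabanUV.T4Continuum.ScalarBlockTrialFunction (digits)
open Summit.QuantumFields.BalabanUV.T4Continuum.ScalarBlockPoincare (nsq_smul)
open Summit.QuantumFields.BalabanUV.T4Continuum.BalabanBlockPoincare (nsq_mulVec_le_rect)
open Summit.QuantumFields.BalabanUV.T4Continuum.CovariantBlockAveraging (opNorm_le_of_sq_le' opNorm_QvOp_le)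
open Summit.QuantumFields.BalabanUV.Beta.GAN24.DirichletBoxTrace (blockReg)

variable {d : ℕ}

/-! ## §1 One level: the mass term of `Δ_a(Ω₀)` is the compression of the torus mass term; fine digits vs coarse digits -/

section OneLevel

variable (n : ℕ) [NeZero n] (M : Fin d → ℕ) [hM : ∀ μ, NeZero (M μ)] (S : Tor M → Prop) [DecidablePred S]

/-- `avgR = Q_n·selᴴ` (the region's line-sum averaging keeps every row of `Q_n`). [folklore] -/
theorem avgR_eq_mul_sel : avgR n M S = QvOp n M * (sel (starReg n M S))ᴴ := by
  ext b a
  rw [mul_sel_conjTranspose_apply]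
  rfl

/-- **the mass term `a n^d·avgRᴴavgR` of `Δ_a(Ω₀)` IS the compression `(a n^d·Q_nᴴQ_n)_{VV}`** of the torus mass term to the star
bonds. [cite: Balaban1985BackgroundPropagators, (3.26) p.395 (shape: `Ω₀(Q*aQ)Ω₀`)] [folklore] -/
theorem massR_eq_toBlock (a : ℝ) :
    (((a * (n : ℝ) ^ d : ℝ)) : ℂ) • ((avgR n M S)ᴴ * avgR n M S)
      = ((((a * (n : ℝ) ^ d : ℝ)) : ℂ) • ((QvOp n M)ᴴ * QvOp n M)).toBlock (starReg n M S) (starReg n M S) := by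
  rw [toBlock_smul, toBlock_eq_sel, avgR_eq_mul_sel, Matrix.conjTranspose_mul, Matrix.conjTranspose_conjTranspose]
  simp only [Matrix.mul_assoc]

end OneLevel

section TwoLevel

variable (n L : ℕ) [NeZero n] [NeZero L] (M : Fin d → ℕ) [hM : ∀ μ, NeZero (M μ)]

/-- fine digits over coarse digits: `digit′_ν(z) / L = digit_ν(par z)`. [folklore] -/
theorem digits_div_eq (z : Tor (fine (L * n) M)) (ν : Fin d) :
    (digits (L * n) M z ν : ℕ) / L = (digits n M (par n L M z) ν : ℕ) := by
  rw [val_digits, val_digits, val_par]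
  exact Nat.mod_mul_right_div_self _ _ _

end TwoLevel

/-! ## §2 The star tower: the truncation defect lives on the non-last-layer children of the DEFICIENT bonds -/

section Tower

variable (L : ℕ) [NeZero L] (M : Fin d → ℕ) [hM : ∀ μ, NeZero (M μ)] (S : Tor M → Prop) [DecidablePred S]

/-- THE TRUNCATED PLANTING off the fine star bonds: `h := (1 − Π_{V′})·J_L·ext u`; pointwise `h x′ = [x′ ∉ V′]·(J_L ext u)(x′)`. [folklore] -/
theorem truncPlant_apply (k : ℕ) (u : pidx L M (starP L M S) k → ℂ) (x : idx L M (k + 1)) :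
    ((1 - (sel (starP L M S (k + 1)))ᴴ * sel (starP L M S (k + 1))) *ᵥ (JpcT L M k *ᵥ ext (starP L M S k) u)) x
      = if starP L M S (k + 1) x then 0 else (JpcT L M k *ᵥ ext (starP L M S k) u) x := by
  rw [Matrix.sub_mulVec, Matrix.one_mulVec, Pi.sub_apply, sel_conjTranspose_mul_sel_mulVec]
  split_ifs <;> simp

/-- **SUPPORT OF THE TRUNCATION DEFECT**: if `h x′ ≠ 0` then `parT x′` is a DEFICIENT coarse star bond and `x′` lies in the top
`L` fine `ν`-layers of its unit block: `digit′_ν x′ + L ≥ L·n_k`. [folklore] -/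
theorem truncPlant_support (k : ℕ) (u : pidx L M (starP L M S) k → ℂ) (x : idx L M (k + 1))
    (hlt : (digits (lev L (k + 1)) M x.1 x.2 : ℕ) + L < lev L (k + 1)) :
    ((1 - (sel (starP L M S (k + 1)))ᴴ * sel (starP L M S (k + 1))) *ᵥ (JpcT L M k *ᵥ ext (starP L M S k) u)) x = 0 := by
  rw [truncPlant_apply]
  split_ifs with hp'
  · rfl
  -- off `V′`: the planted value is `c·(ext u)(parT x′)`; it vanishes unless `parT x′` is a deficient star bond
  rw [JpcT_mulVec_apply]
  by_cases hq : starP L M S k (parT (lev L k) L M x)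
  · exfalso
    have hpar : ¬ blockReg (lev L k) M S (parT (lev L k) L M x).1 := by
      intro hb
      exact hp' (Or.inl ((blockReg_par_iff L M S k x.1).mp hb))
    have hin : blockReg (lev L k) M S ((parT (lev L k) L M x).1 + unitVec (fine (lev L k) M) (parT (lev L k) L M x).2) :=
      hq.resolve_left hpar
    have hne : blockOf (lev L k) M ((parT (lev L k) L M x).1 + unitVec (fine (lev L k) M) (parT (lev L k) L M x).2)
        ≠ blockOf (lev L k) M (parT (lev L k) L M x).1 := by
      intro h
      apply hpar
      unfold blockReg at hin ⊢
      rwa [h] at hin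
    have hdig : (digits (lev L k) M (parT (lev L k) L M x).1 (parT (lev L k) L M x).2 : ℕ) + 1 = lev L k :=
      digit_eq_of_blockOf_ne (lev L k) M _ _ hne
    have hdiv : (digits (lev L (k + 1)) M x.1 x.2 : ℕ) / L = (digits (lev L k) M (parT (lev L k) L M x).1 (parT (lev L k) L M x).2 : ℕ) :=
      digits_div_eq (lev L k) L M x.1 x.2
    have hlt' : (digits (lev L (k + 1)) M x.1 x.2 : ℕ) + L < L * lev L k := lt_of_lt_of_eq hlt rfl
    -- `digit′/L = n_k − 1` contradicts `digit′ + L < L·n_k`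
    have hL : 0 < L := Nat.pos_of_ne_zero (NeZero.ne L)
    set dg := (digits (lev L (k + 1)) M x.1 x.2 : ℕ) with hdg
    have h1 : dg / L + 1 = lev L k := by rw [hdiv]; exact hdig
    have h3 : L * (dg / L) ≤ dg := Nat.mul_div_le _ _
    have h4 : L * lev L k = L * (dg / L) + L := by rw [← h1]; ring
    omega
  · rw [ext_apply_of_not _ _ hq, mul_zero, mul_zero]

/-- **MAJORANT OF THE TRUNCATION DEFECT**: `|h x′| ≤ |(J_L·ext(P_def u))(x′)|` pointwise, where `P_def u` keeps `u` on the DEFICIENT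
star bonds (base point outside `Ω`) only. [folklore] -/
theorem norm_truncPlant_le (k : ℕ) (u : pidx L M (starP L M S) k → ℂ) (x : idx L M (k + 1)) :
    ‖((1 - (sel (starP L M S (k + 1)))ᴴ * sel (starP L M S (k + 1))) *ᵥ (JpcT L M k *ᵥ ext (starP L M S k) u)) x‖
      ≤ ‖(JpcT L M k *ᵥ ext (starP L M S k)
          (fun b => if blockReg (lev L k) M S b.1.1 then 0 else u b)) x‖ := by
  rw [truncPlant_apply]
  split_ifs with hp'
  · rw [norm_zero]; exact norm_nonneg _
  apply le_of_eq
  rw [JpcT_mulVec_apply, JpcT_mulVec_apply]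
  congr 3
  by_cases hq : starP L M S k (parT (lev L k) L M x)
  · rw [ext_apply_of _ _ ⟨_, hq⟩, ext_apply_of _ _ ⟨_, hq⟩]
    have hpar : ¬ blockReg (lev L k) M S (parT (lev L k) L M x).1 := by
      intro hb
      exact hp' (Or.inl ((blockReg_par_iff L M S k x.1).mp hb))
    dsimp only
    rw [if_neg hpar]
  · rw [ext_apply_of_not _ _ hq, ext_apply_of_not _ _ hq]

/-- hence `‖h‖² ≤ ‖P_def u‖²`. [folklore] -/
theorem nsq_truncPlant_le (k : ℕ) (u : pidx L M (starP L M S) k → ℂ) :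
    nsq ((1 - (sel (starP L M S (k + 1)))ᴴ * sel (starP L M S (k + 1))) *ᵥ (JpcT L M k *ᵥ ext (starP L M S k) u))
      ≤ nsq (fun b : pidx L M (starP L M S) k => if blockReg (lev L k) M S b.1.1 then 0 else u b) := by
  set uD : pidx L M (starP L M S) k → ℂ := fun b => if blockReg (lev L k) M S b.1.1 then 0 else u b with huD
  calc nsq ((1 - (sel (starP L M S (k + 1)))ᴴ * sel (starP L M S (k + 1))) *ᵥ (JpcT L M k *ᵥ ext (starP L M S k) u))
      ≤ nsq (JpcT L M k *ᵥ ext (starP L M S k) uD) := by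
        unfold nsq
        exact Finset.sum_le_sum fun x _ => pow_le_pow_left₀ (norm_nonneg _) (norm_truncPlant_le L M S k u x) 2
    _ ≤ ‖JpcT L M k‖ ^ 2 * nsq (ext (starP L M S k) uD) := nsq_mulVec_le_rect _ _
    _ ≤ 1 * nsq uD := by
        rw [nsq_ext]
        refine mul_le_mul_of_nonneg_right ?_ (nsq_nonneg _)
        have h := KingPairingPlantedLaw.opNorm_JpcT_le L M k
        nlinarith [norm_nonneg (JpcT L M k)]
    _ = nsq uD := one_mul _

/-- **THE TRUNCATION TERM IS A `(√n_k)⁻¹` OBJECT**: `‖(a n′^d·Q′ᴴQ′·(1 − Π_{V′})·J_L)_{V′V} u‖² ≤ (a²/n_k)·‖P_def u‖²` — the layer lemma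
(`L` top layers out of `L·n_k`) and the majorant. [folklore] -/
theorem nsq_truncComm_mulVec_le (a : ℝ) (ha : 0 ≤ a) (k : ℕ) (u : pidx L M (starP L M S) k → ℂ) :
    nsq ((((((a * ((lev L (k + 1) : ℕ) : ℝ) ^ d : ℝ)) : ℂ) • ((QvOp (lev L (k + 1)) M)ᴴ * QvOp (lev L (k + 1)) M))
        * (1 - (sel (starP L M S (k + 1)))ᴴ * sel (starP L M S (k + 1))) * JpcT L M k).toBlock
          (starP L M S (k + 1)) (starP L M S k) *ᵥ u)
      ≤ a ^ 2 * (((lev L k : ℕ) : ℝ))⁻¹ * nsq (fun b : pidx L M (starP L M S) k => if blockReg (lev L k) M S b.1.1 then 0 else u b) := by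
  have hL : (0 : ℝ) < L := by exact_mod_cast Nat.pos_of_ne_zero (NeZero.ne L)
  have hn : (0 : ℝ) < ((lev L k : ℕ) : ℝ) := by exact_mod_cast Nat.pos_of_ne_zero (NeZero.ne (lev L k))
  have hn' : (0 : ℝ) < ((lev L (k + 1) : ℕ) : ℝ) := by exact_mod_cast Nat.pos_of_ne_zero (NeZero.ne (lev L (k + 1)))
  set n' := lev L (k + 1) with hn'def
  set Q' := QvOp n' M with hQ'
  set κ' : ℂ := (((a * ((n' : ℕ) : ℝ) ^ d : ℝ)) : ℂ) with hκ'
  set h := (1 - (sel (starP L M S (k + 1)))ᴴ * sel (starP L M S (k + 1))) *ᵥ (JpcT L M k *ᵥ ext (starP L M S k) u) with hh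
  set uD : pidx L M (starP L M S) k → ℂ := fun b => if blockReg (lev L k) M S b.1.1 then 0 else u b with huD
  rw [toBlock_mulVec_rect, ← Matrix.mulVec_mulVec, ← Matrix.mulVec_mulVec, ← hh, Matrix.smul_mulVec, ← Matrix.mulVec_mulVec]
  -- layer lemma at the fine level `n′ = L·n_k`, window `L`
  have hlayer : nsq (Q' *ᵥ h) ≤ (L : ℝ) * (((n' : ℕ) : ℝ))⁻¹ * ((((n' : ℕ) : ℝ)) ^ d)⁻¹ * nsq h :=
    nsq_QvOp_mulVec_le_of_layer n' M L h fun z ν hz => by rw [hh]; exact truncPlant_support L M S k u (z, ν) hz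
  have htr : nsq h ≤ nsq uD := by rw [hh, huD]; exact nsq_truncPlant_le L M S k u
  calc nsq (sel (starP L M S (k + 1)) *ᵥ (κ' • (Q'ᴴ *ᵥ (Q' *ᵥ h))))
      ≤ nsq (κ' • (Q'ᴴ *ᵥ (Q' *ᵥ h))) := nsq_sel_mulVec_le _ _
    _ = ‖κ'‖ ^ 2 * nsq (Q'ᴴ *ᵥ (Q' *ᵥ h)) := nsq_smul _ _
    _ ≤ ‖κ'‖ ^ 2 * (‖Q'ᴴ‖ ^ 2 * nsq (Q' *ᵥ h)) := mul_le_mul_of_nonneg_left (nsq_mulVec_le_rect _ _) (sq_nonneg _)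
    _ ≤ ‖κ'‖ ^ 2 * (((Real.sqrt ((((n' : ℕ) : ℝ)) ^ d))⁻¹) ^ 2 * ((L : ℝ) * (((n' : ℕ) : ℝ))⁻¹ * ((((n' : ℕ) : ℝ)) ^ d)⁻¹ * nsq uD)) := by
        refine mul_le_mul_of_nonneg_left ?_ (sq_nonneg _)
        refine mul_le_mul ?_ (hlayer.trans ?_) (nsq_nonneg _) (sq_nonneg _)
        · rw [Matrix.l2_opNorm_conjTranspose]
          exact pow_le_pow_left₀ (norm_nonneg _) (opNorm_QvOp_le n' M) 2
        · exact mul_le_mul_of_nonneg_left htr (by positivity)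
    _ = a ^ 2 * (((lev L k : ℕ) : ℝ))⁻¹ * nsq uD := by
        have hκn : ‖κ'‖ = a * (((n' : ℕ) : ℝ)) ^ d := by
          rw [hκ', Complex.norm_real, Real.norm_of_nonneg (by positivity)]
        rw [hκn, inv_pow, Real.sq_sqrt (pow_nonneg hn'.le d)]
        have e : ((n' : ℕ) : ℝ) = L * ((lev L k : ℕ) : ℝ) := by
          rw [hn'def, show lev L (k + 1) = L * lev L k from rfl]; push_cast; ring
        rw [e]
        have h1 : ((lev L k : ℕ) : ℝ) ≠ 0 := hn.ne'
        have h2 : (L : ℝ) ≠ 0 := hL.ne'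
        field_simp


/-! ## §3 THE ENDs: the two-level commutator of the MASS TERM of `Δ_a(Ω₀)` with King's compressed planting -/

variable (a : ℝ)

/-- **THE SPLIT**: `JpR·(a n^d avgRᴴavgR) − (a n′^d avgR′ᴴavgR′)·JpR = (X_tor)_{V′V} + (X_tr)_{V′V}` with the TORUS commutator
`X_tor = J_L·(a n^d QᴴQ) − (a n′^d Q′ᴴQ′)·J_L` (downward closure `star_down`: no defect on the coarse side) and the TRUNCATION term
`X_tr = (a n′^d Q′ᴴQ′)·(1 − Π_{V′})·J_L` (the planted children of deficient bonds that are not fine star bonds). [folklore] -/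
theorem massComm_eq (k : ℕ) :
    JpR L M (starP L M S) k * ((((a * ((lev L k : ℕ) : ℝ) ^ d : ℝ)) : ℂ) • ((avgR (lev L k) M S)ᴴ * avgR (lev L k) M S))
        - ((((a * ((lev L (k + 1) : ℕ) : ℝ) ^ d : ℝ)) : ℂ) • ((avgR (lev L (k + 1)) M S)ᴴ * avgR (lev L (k + 1)) M S))
          * JpR L M (starP L M S) k
      = (JpcT L M k * ((((a * ((lev L k : ℕ) : ℝ) ^ d : ℝ)) : ℂ) • ((QvOp (lev L k) M)ᴴ * QvOp (lev L k) M))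
          - ((((a * ((lev L (k + 1) : ℕ) : ℝ) ^ d : ℝ)) : ℂ) • ((QvOp (lev L (k + 1)) M)ᴴ * QvOp (lev L (k + 1)) M)) * JpcT L M k).toBlock
            (starP L M S (k + 1)) (starP L M S k)
        + (((((a * ((lev L (k + 1) : ℕ) : ℝ) ^ d : ℝ)) : ℂ) • ((QvOp (lev L (k + 1)) M)ᴴ * QvOp (lev L (k + 1)) M))
          * (1 - (sel (starP L M S (k + 1)))ᴴ * sel (starP L M S (k + 1))) * JpcT L M k).toBlock
            (starP L M S (k + 1)) (starP L M S k) := by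
  set mT := (((a * ((lev L k : ℕ) : ℝ) ^ d : ℝ)) : ℂ) • ((QvOp (lev L k) M)ᴴ * QvOp (lev L k) M) with hmT
  set mT' := (((a * ((lev L (k + 1) : ℕ) : ℝ) ^ d : ℝ)) : ℂ) • ((QvOp (lev L (k + 1)) M)ᴴ * QvOp (lev L (k + 1)) M) with hmT'
  set J := JpcT L M k with hJ
  have h1 : (((a * ((lev L k : ℕ) : ℝ) ^ d : ℝ)) : ℂ) • ((avgR (lev L k) M S)ᴴ * avgR (lev L k) M S)
      = mT.toBlock (starP L M S k) (starP L M S k) := massR_eq_toBlock (lev L k) M S a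
  have h2 : (((a * ((lev L (k + 1) : ℕ) : ℝ) ^ d : ℝ)) : ℂ) • ((avgR (lev L (k + 1)) M S)ᴴ * avgR (lev L (k + 1)) M S)
      = mT'.toBlock (starP L M S (k + 1)) (starP L M S (k + 1)) := massR_eq_toBlock (lev L (k + 1)) M S a
  have hJpR : JpR L M (starP L M S) k = J.toBlock (starP L M S (k + 1)) (starP L M S k) := rfl
  rw [h1, h2, hJpR]
  -- coarse side: downward closure, no defect
  have hT1 : J.toBlock (starP L M S (k + 1)) (starP L M S k) * mT.toBlock (starP L M S k) (starP L M S k)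
      = (J * mT).toBlock (starP L M S (k + 1)) (starP L M S k) :=
    (toBlock_mul_of_vanish_left _ _ _ _ _ (JpcT_vanish L M (starP L M S) (star_down L M S) k)).symm
  -- fine side: the indicator of `V′` appears in the middle
  have hT2 : mT'.toBlock (starP L M S (k + 1)) (starP L M S (k + 1)) * J.toBlock (starP L M S (k + 1)) (starP L M S k)
      = (mT' * ((sel (starP L M S (k + 1)))ᴴ * sel (starP L M S (k + 1))) * J).toBlock (starP L M S (k + 1)) (starP L M S k) := by
    rw [toBlock_eq_sel, toBlock_eq_sel, toBlock_eq_sel]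
    simp only [Matrix.mul_assoc]
  rw [hT1, hT2, ← toBlock_sub, ← toBlock_add]
  congr 1
  rw [Matrix.mul_sub, Matrix.sub_mul, Matrix.mul_one]
  abel

/-- **THE MASS-TERM COMMUTATOR, VECTOR FORM** (any union `S`, any `k`, `0 ≤ a`, `n = n_k = L^k`): for every coarse star-bond field `u`,
`√nsq(C_M u) ≤ 3a·n⁻¹·√nsq u + a·(√n)⁻¹·√nsq(P_def u)`, `P_def u` = `u` kept on the DEFICIENT star bonds only — the torus commutator
(`3a/n`, both pairing identities) plus the truncation term (`a/√n`, the layer lemma).  With leaf-06-g6's trace inequality on `P_def`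
(`RegionStarTrace.trace_deficient_le`) the second term is also of the `n⁻¹` class on interior-`W2` budgets. [folklore] -/
theorem sqrt_nsq_massComm_mulVec_le (ha : 0 ≤ a) (k : ℕ) (u : pidx L M (starP L M S) k → ℂ) :
    Real.sqrt (nsq ((JpR L M (starP L M S) k * ((((a * ((lev L k : ℕ) : ℝ) ^ d : ℝ)) : ℂ) • ((avgR (lev L k) M S)ᴴ * avgR (lev L k) M S))
        - ((((a * ((lev L (k + 1) : ℕ) : ℝ) ^ d : ℝ)) : ℂ) • ((avgR (lev L (k + 1)) M S)ᴴ * avgR (lev L (k + 1)) M S))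
          * JpR L M (starP L M S) k) *ᵥ u))
      ≤ 3 * a * (((lev L k : ℕ) : ℝ))⁻¹ * Real.sqrt (nsq u)
        + a * (Real.sqrt ((lev L k : ℕ) : ℝ))⁻¹
          * Real.sqrt (nsq (fun b : pidx L M (starP L M S) k => if blockReg (lev L k) M S b.1.1 then 0 else u b)) := by
  have hn : (0 : ℝ) < ((lev L k : ℕ) : ℝ) := by exact_mod_cast Nat.pos_of_ne_zero (NeZero.ne (lev L k))
  rw [massComm_eq, Matrix.add_mulVec]
  refine (sqrt_nsq_add_le _ _).trans (add_le_add ?_ ?_)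
  · refine (sqrt_nsq_mulVec_le_rect _ u).trans (mul_le_mul_of_nonneg_right ?_ (Real.sqrt_nonneg _))
    refine (opNorm_toBlock_le _ _ _).trans ?_
    exact opNorm_JK_massComm_le (lev L k) L M a ha
  · have h := nsq_truncComm_mulVec_le L M S a ha k u
    refine (Real.sqrt_le_sqrt h).trans (le_of_eq ?_)
    rw [Real.sqrt_mul (by positivity), Real.sqrt_mul (sq_nonneg _), Real.sqrt_sq ha, Real.sqrt_inv]

/-- **THE MASS-TERM COMMUTATOR IN OPERATOR NORM**: `‖JpR·(a n^d avgRᴴavgR) − (a n′^d avgR′ᴴavgR′)·JpR‖ ≤ 4a·(√n_k)⁻¹` for EVERY union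
of blocks `S`, every level `k` — NO coercivity, NO regularity, NO box hypothesis.  (The rate `n_k^{−1/2}` is expected to be sharp
for this term in operator norm — the indicator of one face of deficient bonds, hand computation, not a kernel statement; the torus part
alone is `3a·n_k⁻¹`.) [folklore] -/
theorem opNorm_massComm_le (ha : 0 ≤ a) (k : ℕ) :
    ‖JpR L M (starP L M S) k * ((((a * ((lev L k : ℕ) : ℝ) ^ d : ℝ)) : ℂ) • ((avgR (lev L k) M S)ᴴ * avgR (lev L k) M S))
        - ((((a * ((lev L (k + 1) : ℕ) : ℝ) ^ d : ℝ)) : ℂ) • ((avgR (lev L (k + 1)) M S)ᴴ * avgR (lev L (k + 1)) M S))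
          * JpR L M (starP L M S) k‖
      ≤ 4 * a * (Real.sqrt ((lev L k : ℕ) : ℝ))⁻¹ := by
  have hn1 : (1 : ℝ) ≤ ((lev L k : ℕ) : ℝ) := by exact_mod_cast BalabanAveragedTowerUnit.one_le_lev' L k
  have hn : (0 : ℝ) < ((lev L k : ℕ) : ℝ) := by linarith
  have hsn : 0 < Real.sqrt (((lev L k : ℕ) : ℝ)) := Real.sqrt_pos.mpr hn
  have hinv : (((lev L k : ℕ) : ℝ))⁻¹ ≤ (Real.sqrt ((lev L k : ℕ) : ℝ))⁻¹ := by
    refine inv_anti₀ hsn (Real.sqrt_le_iff.mpr ⟨hn.le, ?_⟩)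
    nlinarith
  refine opNorm_le_of_sq_le' _ (by positivity) fun u => ?_
  set C := JpR L M (starP L M S) k * ((((a * ((lev L k : ℕ) : ℝ) ^ d : ℝ)) : ℂ) • ((avgR (lev L k) M S)ᴴ * avgR (lev L k) M S))
        - ((((a * ((lev L (k + 1) : ℕ) : ℝ) ^ d : ℝ)) : ℂ) • ((avgR (lev L (k + 1)) M S)ᴴ * avgR (lev L (k + 1)) M S))
          * JpR L M (starP L M S) k with hC
  have e0 : ∑ b, ‖∑ i, C b i * u i‖ ^ 2 = nsq (C *ᵥ u) := rfl
  have e1 : ∑ j, ‖u j‖ ^ 2 = nsq u := rfl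
  rw [e0, e1]
  set uD : pidx L M (starP L M S) k → ℂ := fun b => if blockReg (lev L k) M S b.1.1 then 0 else u b with huD
  have hD : Real.sqrt (nsq uD) ≤ Real.sqrt (nsq u) := by
    refine Real.sqrt_le_sqrt (Finset.sum_le_sum fun b _ => ?_)
    rw [huD]; dsimp only; split_ifs <;> simp
  have h1 := sqrt_nsq_massComm_mulVec_le L M S a ha k u
  rw [← hC, ← huD] at h1
  have h2 : Real.sqrt (nsq (C *ᵥ u)) ≤ 4 * a * (Real.sqrt ((lev L k : ℕ) : ℝ))⁻¹ * Real.sqrt (nsq u) := by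
    have hu0 : 0 ≤ Real.sqrt (nsq u) := Real.sqrt_nonneg _
    calc Real.sqrt (nsq (C *ᵥ u))
        ≤ 3 * a * (((lev L k : ℕ) : ℝ))⁻¹ * Real.sqrt (nsq u) + a * (Real.sqrt ((lev L k : ℕ) : ℝ))⁻¹ * Real.sqrt (nsq uD) := h1
      _ ≤ 3 * a * (Real.sqrt ((lev L k : ℕ) : ℝ))⁻¹ * Real.sqrt (nsq u) + a * (Real.sqrt ((lev L k : ℕ) : ℝ))⁻¹ * Real.sqrt (nsq u) := by
          gcongr
      _ = 4 * a * (Real.sqrt ((lev L k : ℕ) : ℝ))⁻¹ * Real.sqrt (nsq u) := by ring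
  have h3 := pow_le_pow_left₀ (Real.sqrt_nonneg _) h2 2
  rw [Real.sq_sqrt (nsq_nonneg _), mul_pow, Real.sq_sqrt (nsq_nonneg _)] at h3
  exact h3

omit [NeZero L] hM [DecidablePred S] in
/-- the tower's rate currency: `(√n_k)⁻¹ = ((√L)⁻¹)^k`. [folklore] -/
theorem sqrt_lev_inv (k : ℕ) : (Real.sqrt ((lev L k : ℕ) : ℝ))⁻¹ = ((Real.sqrt L)⁻¹) ^ k := by
  rw [cast_lev', inv_pow]
  congr 1
  have hL : (0 : ℝ) ≤ L := Nat.cast_nonneg L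
  rw [show ((L : ℝ)) ^ k = ((Real.sqrt L) ^ k) ^ 2 by rw [← pow_mul, mul_comm, pow_mul, Real.sq_sqrt hL],
    Real.sqrt_sq (pow_nonneg (Real.sqrt_nonneg _) k)]

/-- **THE MASS-TERM COMMUTATOR AT THE TOWER RATE `(√L)⁻¹`**: `‖JpR_k·massA_k − massA_{k+1}·JpR_k‖ ≤ 4a·((√L)⁻¹)^k`. [folklore] -/
theorem opNorm_massComm_le_rate (ha : 0 ≤ a) (k : ℕ) :
    ‖JpR L M (starP L M S) k * ((((a * ((lev L k : ℕ) : ℝ) ^ d : ℝ)) : ℂ) • ((avgR (lev L k) M S)ᴴ * avgR (lev L k) M S))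
        - ((((a * ((lev L (k + 1) : ℕ) : ℝ) ^ d : ℝ)) : ℂ) • ((avgR (lev L (k + 1)) M S)ᴴ * avgR (lev L (k + 1)) M S))
          * JpR L M (starP L M S) k‖
      ≤ 4 * a * ((Real.sqrt L)⁻¹) ^ k := by
  rw [← sqrt_lev_inv]; exact opNorm_massComm_le L M S a ha k

/-- **THE (P-mass) PAIRING in the currency of the owner's `RegionStarInjectedPairing.opNorm_injected_le_of_pairing`** (for the
COMPRESSED planting `JpR`): `‖⟨v, (JpR_k·massA_k − massA_{k+1}·JpR_k) u⟩‖ ≤ (4a·((√L)⁻¹)^k)·√nsq u·√nsq v` — budgets `E = E′ = nsq`,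
so `Λ = Λ′ = ‖G‖` (coercivity alone). [folklore] -/
theorem mass_pairing_le (ha : 0 ≤ a) (k : ℕ) (u : pidx L M (starP L M S) k → ℂ) (v : pidx L M (starP L M S) (k + 1) → ℂ) :
    ‖star v ⬝ᵥ ((JpR L M (starP L M S) k * ((((a * ((lev L k : ℕ) : ℝ) ^ d : ℝ)) : ℂ) • ((avgR (lev L k) M S)ᴴ * avgR (lev L k) M S))
        - ((((a * ((lev L (k + 1) : ℕ) : ℝ) ^ d : ℝ)) : ℂ) • ((avgR (lev L (k + 1)) M S)ᴴ * avgR (lev L (k + 1)) M S))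
          * JpR L M (starP L M S) k) *ᵥ u)‖
      ≤ (4 * a * ((Real.sqrt L)⁻¹) ^ k) * Real.sqrt (nsq u) * Real.sqrt (nsq v) := by
  refine (norm_star_dotProduct_le v _).trans ?_
  have h := (sqrt_nsq_mulVec_le_rect _ u).trans
    (mul_le_mul_of_nonneg_right (opNorm_massComm_le_rate L M S a ha k) (Real.sqrt_nonneg (nsq u)))
  calc Real.sqrt (nsq v) * Real.sqrt (nsq ((JpR L M (starP L M S) k
          * ((((a * ((lev L k : ℕ) : ℝ) ^ d : ℝ)) : ℂ) • ((avgR (lev L k) M S)ᴴ * avgR (lev L k) M S))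
        - ((((a * ((lev L (k + 1) : ℕ) : ℝ) ^ d : ℝ)) : ℂ) • ((avgR (lev L (k + 1)) M S)ᴴ * avgR (lev L (k + 1)) M S))
          * JpR L M (starP L M S) k) *ᵥ u))
      ≤ Real.sqrt (nsq v) * (4 * a * ((Real.sqrt L)⁻¹) ^ k * Real.sqrt (nsq u)) :=
        mul_le_mul_of_nonneg_left h (Real.sqrt_nonneg _)
    _ = (4 * a * ((Real.sqrt L)⁻¹) ^ k) * Real.sqrt (nsq u) * Real.sqrt (nsq v) := by ring

end Tower

end Summit.QuantumFields.BalabanUV.T4Continuum.RegionMassTwoLevel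

end
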